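import Mathlib
import Summits.NavierStokesRegularity.NavierStokesRegularity.Theorems.EulerZoomLiouvillePowerGaugeEulerLiouvilleSelfSimilarUniformlyContinuousLoc
import Summits.NavierStokesRegularity.NavierStokesRegularity.Theorems.EulerZoomLiouvillePowerGaugeEulerLiouvilleEnergySaturationMember
import HarnessLib

/-!
# A decorative binder of THE ONE STATEMENT of the crux `EulerZoomLiouville.PowerGaugeEulerLiouville`:
# uniform continuity of the profile implies irrotational piercing (vacuously)

Route №10 `EulerZoomLiouville` (NavierStokesRegularity), crux E = stmt-NavierStokesRegularity-19832,
registered open stub `stub_selfSimilarC2Needle`.  From skeleton v39 on the needle stub carries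
`¬ HasIrrotationalPiercing ρ V` (`HasIrrotationalPiercing ρ V := ∀ R₀, ∃ R ≥ R₀, ∀ y, ‖y‖ = R →
⟪y, V y⟫ ≤ −‖y‖²/(2+ρ) → curl V y = 0`), and the LEAD's v43 draft spells the tame side as
`UniformContinuous V ∨ HasIrrotationalPiercing ρ V`.  This file records that the first disjunct
IMPLIES the second for every profile with the class's `A`-growth: by the tree's spike estimate
(`Loc.sublinear_of_uniformContinuous_of_growth`: uniform continuity + `∫_{B_L}|V|² ≤ C L^{1−2ρ}` ⇒
`V(y) = o(|y|)`), far out `⟪y, V y⟫ ≥ −‖y‖‖V y‖ > −‖y‖²/(2+ρ)`, so large spheres carry NO fast-inflow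
point and the piercing condition holds vacuously on every sphere beyond some radius.

* `Binders.hasIrrotationalPiercing_of_uniformContinuous` — profile level (growth + UC ⇒ piercing);
* `Binders.not_uniformContinuous_of_not_piercing` — member level, crux binders verbatim + exact
  self-similarity: `¬ HasIrrotationalPiercing ρ V → ¬ UniformContinuous V`.  Hence THE ONE STATEMENT's
  binder `¬ UniformContinuous V` (v43 draft) is implied by `¬ HasIrrotationalPiercing ρ V` and may be
  dropped, and `IsTameC2Profile` may be spelled `ContDiff ℝ 2 V ∧ HasIrrotationalPiercing ρ V`.

WHAT THIS IS NOT: not NS, not E, not the stub — bookkeeping; `--supports` stmt-19832. [folklore]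
-/

noncomputable section

-- flat `Theorems/<Route><Decl>…` files of one crux share the namespace of the crux (tree convention)
set_option linter.dupNamespace false

open MeasureTheory Set Filter Topology Metric Function
open scoped ENNReal NNReal RealInnerProductSpace

namespace Summit.NavierStokesRegularity.NavierStokesRegularity.Theorems.PowerGaugeEulerLiouville

open Literature.Analysis Literature.Analysis.FluidPDE

namespace Binders

/-- **Uniform continuity ⇒ irrotational piercing, vacuously.**  A uniformly continuous
`V : ℝ³ → ℝ³` with the `A`-growth `∫_{B_L} |V|² ≤ C L^{1−2ρ}` (`L > 0`, `C < ∞`, `ρ > −1/2`) has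
sublinear growth, so for every sphere beyond some radius there is no point with
`⟪y, V y⟫ ≤ −‖y‖²/(2+ρ)`; in particular `HasIrrotationalPiercing ρ V` (shape verbatim). [folklore] -/
theorem hasIrrotationalPiercing_of_uniformContinuous {ρ : ℝ} (hρ : -1 / 2 < ρ)
    {V : EuclideanSpace ℝ (Fin 3) → EuclideanSpace ℝ (Fin 3)} (hUC : UniformContinuous V)
    {C : ℝ≥0∞} (hC : C ≠ ⊤)
    (hA : ∀ L : ℝ, 0 < L →
      ∫⁻ y in ball (0 : EuclideanSpace ℝ (Fin 3)) L, ‖V y‖ₑ ^ 2 ≤ C * ENNReal.ofReal (L ^ (1 - 2 * ρ))) :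
    ∀ R₀ : ℝ, ∃ R : ℝ, R₀ ≤ R ∧ ∀ y : EuclideanSpace ℝ (Fin 3), ‖y‖ = R →
      inner ℝ y (V y) ≤ -(1 / (2 + ρ) * ‖y‖ ^ 2) → curl V y = 0 := by
  have h2ρ : (0 : ℝ) < 2 + ρ := by linarith
  have hγ : (0 : ℝ) < 1 / (2 + ρ) := by positivity
  -- sublinear growth with slope `γ/2`
  obtain ⟨R₁, hR₁⟩ := Loc.sublinear_of_uniformContinuous_of_growth hUC hC (θ := 1 - 2 * ρ)
    (by linarith) hA (1 / (2 + ρ) / 2) (by positivity)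
  intro R₀
  refine ⟨max R₀ (max R₁ 1), le_max_left _ _, fun y hy hinfl => ?_⟩
  exfalso
  have hyR₁ : R₁ ≤ ‖y‖ := by rw [hy]; exact (le_max_left _ _).trans (le_max_right _ _)
  have hy0 : 0 < ‖y‖ := by rw [hy]; exact lt_of_lt_of_le one_pos ((le_max_right _ _).trans (le_max_right _ _))
  have hV := hR₁ y hyR₁
  -- `⟪y, V y⟫ ≥ -‖y‖ ‖V y‖ ≥ -(γ/2) ‖y‖²`
  have hcs : -(‖y‖ * ‖V y‖) ≤ inner ℝ y (V y) := by
    have := abs_real_inner_le_norm y (V y)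
    have := neg_abs_le (inner ℝ y (V y))
    linarith
  have h1 : ‖y‖ * ‖V y‖ ≤ 1 / (2 + ρ) / 2 * ‖y‖ ^ 2 := by
    calc ‖y‖ * ‖V y‖ ≤ ‖y‖ * (1 / (2 + ρ) / 2 * ‖y‖) := mul_le_mul_of_nonneg_left hV (norm_nonneg _)
      _ = 1 / (2 + ρ) / 2 * ‖y‖ ^ 2 := by ring
  have h2 : 0 < 1 / (2 + ρ) / 2 * ‖y‖ ^ 2 := by positivity
  linarith

/-- **THE ONE STATEMENT's binder `¬ UniformContinuous V` is decorative given
`¬ HasIrrotationalPiercing ρ V`.**  For a member of the crux's class (`0 < ρ < 1`; crux binders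
verbatim) exactly self-similar about the origin with velocity profile `V`:
`¬ HasIrrotationalPiercing ρ V → ¬ UniformContinuous V` (shapes verbatim; the `A`-growth of the
profile is `EnergySaturation.profileData_of_selfSimilar`, conjunct 6). [folklore] -/
theorem not_uniformContinuous_of_not_piercing {ρ : ℝ} (hρ : 0 < ρ) (hρ1 : ρ < 1)
    {u : ℝ → EuclideanSpace ℝ (Fin 3) → EuclideanSpace ℝ (Fin 3)} {p : ℝ → EuclideanSpace ℝ (Fin 3) → ℝ}
    {H : ℝ → EuclideanSpace ℝ (Fin 3) → EuclideanSpace ℝ (Fin 3) →L[ℝ] EuclideanSpace ℝ (Fin 3)} {c : ℝ≥0}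
    (hsw : IsSuitableWeakSolutionOn (slab (EuclideanSpace ℝ (Fin 3)) (Iio 0) isOpen_Iio) 0 0 u p)
    (hH : HasWeakSpatialGradientOn (slab (EuclideanSpace ℝ (Fin 3)) (Iio 0) isOpen_Iio) u H)
    (hgauge : ∀ a : ℝ, 0 < a →
      ENNReal.ofReal (a ^ (2 * ρ)) * cknA a (0 : ℝ × EuclideanSpace ℝ (Fin 3)) u +
          ENNReal.ofReal (a ^ ρ) * cknE a (0 : ℝ × EuclideanSpace ℝ (Fin 3)) H +
        ENNReal.ofReal (a ^ (2 * ρ)) * cknD a (0 : ℝ × EuclideanSpace ℝ (Fin 3)) p ≤ (c : ℝ≥0∞))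
    {V : EuclideanSpace ℝ (Fin 3) → EuclideanSpace ℝ (Fin 3)} {P : EuclideanSpace ℝ (Fin 3) → ℝ}
    (hu : ∀ τ : ℝ, τ < 0 → u τ = selfSimilarCollapse (1 / (2 + ρ)) 0 V τ)
    (hp : ∀ τ : ℝ, τ < 0 → p τ = selfSimilarCollapsePressure (1 / (2 + ρ)) 0 P τ)
    (hnp : ¬ ∀ R₀ : ℝ, ∃ R : ℝ, R₀ ≤ R ∧ ∀ y : EuclideanSpace ℝ (Fin 3), ‖y‖ = R →
      inner ℝ y (V y) ≤ -(1 / (2 + ρ) * ‖y‖ ^ 2) → curl V y = 0) :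
    ¬ UniformContinuous V := by
  intro hUC
  obtain ⟨G, -, -, -, -, -, hA, -⟩ :=
    EnergySaturation.profileData_of_selfSimilar hρ hρ1 hsw hH hgauge hu hp
  exact hnp (hasIrrotationalPiercing_of_uniformContinuous (by linarith) hUC ENNReal.coe_ne_top hA)

/-- The same as an implication of the positive predicates (member level): a uniformly continuous
velocity profile of an exactly self-similar member HAS irrotational piercing. [folklore] -/
theorem hasIrrotationalPiercing_of_selfSimilar_of_uniformContinuous {ρ : ℝ} (hρ : 0 < ρ) (hρ1 : ρ < 1)
    {u : ℝ → EuclideanSpace ℝ (Fin 3) → EuclideanSpace ℝ (Fin 3)} {p : ℝ → EuclideanSpace ℝ (Fin 3) → ℝ}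
    {H : ℝ → EuclideanSpace ℝ (Fin 3) → EuclideanSpace ℝ (Fin 3) →L[ℝ] EuclideanSpace ℝ (Fin 3)} {c : ℝ≥0}
    (hsw : IsSuitableWeakSolutionOn (slab (EuclideanSpace ℝ (Fin 3)) (Iio 0) isOpen_Iio) 0 0 u p)
    (hH : HasWeakSpatialGradientOn (slab (EuclideanSpace ℝ (Fin 3)) (Iio 0) isOpen_Iio) u H)
    (hgauge : ∀ a : ℝ, 0 < a →
      ENNReal.ofReal (a ^ (2 * ρ)) * cknA a (0 : ℝ × EuclideanSpace ℝ (Fin 3)) u +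
          ENNReal.ofReal (a ^ ρ) * cknE a (0 : ℝ × EuclideanSpace ℝ (Fin 3)) H +
        ENNReal.ofReal (a ^ (2 * ρ)) * cknD a (0 : ℝ × EuclideanSpace ℝ (Fin 3)) p ≤ (c : ℝ≥0∞))
    {V : EuclideanSpace ℝ (Fin 3) → EuclideanSpace ℝ (Fin 3)} {P : EuclideanSpace ℝ (Fin 3) → ℝ}
    (hu : ∀ τ : ℝ, τ < 0 → u τ = selfSimilarCollapse (1 / (2 + ρ)) 0 V τ)
    (hp : ∀ τ : ℝ, τ < 0 → p τ = selfSimilarCollapsePressure (1 / (2 + ρ)) 0 P τ)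
    (hUC : UniformContinuous V) :
    ∀ R₀ : ℝ, ∃ R : ℝ, R₀ ≤ R ∧ ∀ y : EuclideanSpace ℝ (Fin 3), ‖y‖ = R →
      inner ℝ y (V y) ≤ -(1 / (2 + ρ) * ‖y‖ ^ 2) → curl V y = 0 := by
  obtain ⟨G, -, -, -, -, -, hA, -⟩ :=
    EnergySaturation.profileData_of_selfSimilar hρ hρ1 hsw hH hgauge hu hp
  exact hasIrrotationalPiercing_of_uniformContinuous (by linarith) hUC ENNReal.coe_ne_top hA

end Binders

end Summit.NavierStokesRegularity.NavierStokesRegularity.Theorems.PowerGaugeEulerLiouville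

end
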